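import Literature.AlgebraicGeometry.ShimuraVarieties.UnitaryBallPeterssonRecord
import HarnessLib

/-!
# The image of the arithmetic group in `U(2,1)` is monotone in the group — across two ball quotient data

For two compact ball quotient surfaces `D : UnitaryBallUniformisationDatum 2 X`, `D' : UnitaryBallUniformisationDatum 2 X'`
read in Sylvester frames with the SAME matrix (`𝔣'.t = 𝔣.t`), the representation
`ballRep 𝔣 : Γ → U(2,1)`, `γ ↦ t⁻¹ γ^{τ₁} t` (`mat_ballRep`) only sees the image of `γ` in `GL₃(ℂ)`.
Hence:

* `UnitaryBallUniformisationDatum.mat_ballRep_eq_of_map_eq` — if `γ ∈ Γ_D` and `γ' ∈ Γ_{D'}` have the same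
  image in `GL₃(ℂ)`, then `ballRep 𝔣 γ = ballRep 𝔣' γ'`;
* `UnitaryBallUniformisationDatum.ballImage_le_of_map_le` — **if the image of `Γ_{D'}` in `GL₃(ℂ)` is
  contained in that of `Γ_D`, then `D'.ballImage 𝔣' ≤ D.ballImage 𝔣`** (and `…_eq_of_map_eq`).

This is the level bookkeeping of the level-change clause for theta classes of a tower of ball
quotients `X_{Γ'} → X_Γ` (`Γ' ≤ Γ`), where the data of the two levels are separate structures whose
groups agree only through their images in `GL₃(ℂ)` (as in a coded universe of Picard modular
surfaces). PROVED lemma (Mathlib + tree); no new axioms. [folklore]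
[cite: BergeronMillsonMoeglin2016Balls, Part 2 §1.2]
-/

noncomputable section

open Matrix
open Literature.Geometry.ComplexHyperbolic
open Literature.Geometry.ComplexHyperbolic.BallModel (U21 mat)

namespace Literature.AlgebraicGeometry.ShimuraVarieties

namespace UnitaryBallUniformisationDatum

variable {X X' : Motives.SchemeOver ℂ} (D : UnitaryBallUniformisationDatum 2 X)
  (D' : UnitaryBallUniformisationDatum 2 X') (𝔣 : D.SylvesterFrame) (𝔣' : D'.SylvesterFrame)

/-- **`ballRep` only sees the image in `GL₃(ℂ)`**: for frames with the same matrix, elements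
`γ ∈ Γ_D`, `γ' ∈ Γ_{D'}` with the same complex matrix have the same image in `U(2,1)`.
[cite: BergeronMillsonMoeglin2016Balls, Part 2 §1.2] -/
theorem ballRep_eq_of_map_eq (hT : 𝔣'.t = 𝔣.t) (γ : D.Γ) (γ' : D'.Γ)
    (h : Matrix.GeneralLinearGroup.map (D'.E.subtype : D'.E →+* ℂ) (γ' : GL (Fin 3) D'.E) =
      Matrix.GeneralLinearGroup.map (D.E.subtype : D.E →+* ℂ) (γ : GL (Fin 3) D.E)) :
    D'.ballRep 𝔣' γ' = D.ballRep 𝔣 γ := by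
  have hTT : 𝔣'.T = 𝔣.T := Units.ext hT
  have hm : (((γ' : GL (Fin 3) D'.E) : Matrix (Fin 3) (Fin 3) D'.E).map D'.τ₁) =
      (((γ : GL (Fin 3) D.E) : Matrix (Fin 3) (Fin 3) D.E).map D.τ₁) := by
    simpa using congrArg (fun g : GL (Fin 3) ℂ ↦ (g : Matrix (Fin 3) (Fin 3) ℂ)) h
  apply Subtype.ext
  apply Units.ext
  change mat (D'.ballRep 𝔣' γ') = mat (D.ballRep 𝔣 γ)
  rw [mat_ballRep, mat_ballRep, hm, SylvesterFrame.ti, SylvesterFrame.ti, hTT, hT]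

/-- **Monotonicity of the image in `U(2,1)`**: if the image of `Γ_{D'}` in `GL₃(ℂ)` lies in the image
of `Γ_D`, then `ρ_{𝔣'}(Γ_{D'}) ≤ ρ_𝔣(Γ_D)` for frames with the same matrix.
[cite: BergeronMillsonMoeglin2016Balls, Part 2 §1.2] -/
theorem ballImage_le_of_map_le (hT : 𝔣'.t = 𝔣.t)
    (hΓ : D'.Γ.map (Matrix.GeneralLinearGroup.map (D'.E.subtype : D'.E →+* ℂ)) ≤
      D.Γ.map (Matrix.GeneralLinearGroup.map (D.E.subtype : D.E →+* ℂ))) :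
    D'.ballImage 𝔣' ≤ D.ballImage 𝔣 := by
  rintro g ⟨γ', -, rfl⟩
  obtain ⟨γ₀, hγ₀, hγ⟩ := hΓ ⟨(γ' : GL (Fin 3) D'.E), γ'.2, rfl⟩
  refine ⟨⟨γ₀, hγ₀⟩, trivial, ?_⟩
  exact (D.ballRep_eq_of_map_eq D' 𝔣 𝔣' hT ⟨γ₀, hγ₀⟩ γ' hγ.symm).symm

/-- The images agree when the images in `GL₃(ℂ)` agree. [cite: BergeronMillsonMoeglin2016Balls, Part 2 §1.2] -/
theorem ballImage_eq_of_map_eq (hT : 𝔣'.t = 𝔣.t)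
    (hΓ : D'.Γ.map (Matrix.GeneralLinearGroup.map (D'.E.subtype : D'.E →+* ℂ)) =
      D.Γ.map (Matrix.GeneralLinearGroup.map (D.E.subtype : D.E →+* ℂ))) :
    D'.ballImage 𝔣' = D.ballImage 𝔣 :=
  le_antisymm (D.ballImage_le_of_map_le D' 𝔣 𝔣' hT hΓ.le)
    (D'.ballImage_le_of_map_le D 𝔣' 𝔣 hT.symm hΓ.ge)

end UnitaryBallUniformisationDatum

end Literature.AlgebraicGeometry.ShimuraVarieties

end
-- build re-queue 2026-08-21T18:23:28Z (C-7 stale olean; ops/buildfix word 18:3xZ): comment-only, no declaration changed
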